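/-
Literature/Probability/FitznerVanDerHofstad2017/SrwCountEgfKernel.lean   (NEW, additive, d-generic)

Fast kernel rows of the simple-random-walk and non-backtracking end-point counts: the product of the
one-dimensional exponential generating polynomials, packed into ONE natural number per coordinate value
(Kronecker substitution), so that the Lean kernel's GMP-accelerated `Nat` arithmetic evaluates a whole row
`[c_0(x), …, c_L(x)]` with `O(d)` big-number operations.
-/
import Literature.Probability.FitznerVanDerHofstad2017.NbwCountKernel
import HarnessLib

/-!
# Fast kernel rows of the SRW / NBW end-point counts (EGF product × Kronecker packing)

Companion of `NbwCountKernel` (the row form `nbwCountRow L A x` over `SrwCount.srwCountRow`, one binomial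
convolution level per coordinate).  For the class-by-class bookkeeping of the explicit terms of [NoBLE17-I]
§5.3.3 at table-range cuts (`L = 22`, some two thousand live classes per order range at `d = 10, 11`) that row
form costs about half a second of kernel time per class; this module replaces the `d` convolution levels by
ONE product of natural numbers.

## The identity

For a point `x ∈ ℤ^d` with coordinate magnitudes `|x_j| = c_j`, the number `c_m(x) = srwCount d m x` of `m`-step
nearest-neighbour walks `0 → x` is the multinomial convolution of the one-dimensional counts
`walk1(a, c) = #{a-step ±1 walks 0 → c}` ([NoBLE17-I] §5.1.1 (5.4)–(5.5): the step law is the uniform mixture of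
the `2d` coordinate moves), i.e. with the exponential generating polynomials `U_c(s) = Σ_a walk1(a,c) s^a/a!`,

  `c_m(x) = m! · [s^m] Π_{j<d} U_{c_j}(s)`.

Scaling by `L!` and truncating at degree `L` keeps everything in `ℕ`: `u_{c,a} = walk1(a,c)·L!/a!` (`a ≤ L`),
`m! · [s^m] Π_j (Σ_a u_{c_j,a} s^a) = (L!)^d · c_m(x)` for `m ≤ L` (`factorial_mul_coeff_egfProd`, proved from the
dimension recursion `SrwCount.G_succ`).

## The kernel form

Each scaled polynomial is packed into the natural number `U_c(B) = Σ_a u_{c,a} B^a` at the base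
`B = ((L+1)·2^L·L!)^d + 1`, which exceeds every coefficient of the `d`-fold product (`coeff_egfProd_le`); the
product over the coordinates is `|cs|` multiplications and one power `U_0(B)^{d−|cs|}` for the zero coordinates
(`srwEgfPacked`), and coefficient `m` is read back as `N / B^m % B` (`eval_div_pow_mod_eq_coeff`).  Hence

* `srwCountRowFast d L cs` — the row `[c_0(x), …, c_L(x)]` of the point with magnitude list `cs`
  (`srwCountRowFast_getD`: `= srwCount d m x`);
* `nbwCountRowFast d L cs` — the NBW row `[b_0(x), …, b_L(x)]`, `b_n = Σ_j [P_n]_j c_j` ([MS93] (5.3.3), the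
  coefficient lists `nbwPolyCoef` of `NbwCountKernel`) (`nbwCountRowFast_getD`: `= #nbwWordsTo d n x`);
* `nbwAtomFast d L l r` — the table atom `b_r(canonSite d l)` of a multiplicity list `l` (the live classes of
  `LiveEndpointClasses`), read off ONE fast row of cut `L` (`nbwAtomFast_eq_card`, `nbwAtomFast_eq_nbwAtom`).

Measured on the build farm (kernel-cost census only; `decide +kernel`, `d = 10`, `L = 22`): about `30 ms`
per SRW row and `80 ms` per NBW row, against `≈ 0.5 s` for the convolution row form — the consumer is
`WbxCellKernel` (the rational evaluator of the `WBX(M)` cell, `≈ 0.07 s` per live class all told).  Every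
statement is `d`-generic; no numeral of any record enters; pointer language throughout (walk counts, no
statement about percolation in any dimension).

References: [NoBLE17-I] = `FitznerVanDerHofstad2016NoBLE` (§5.1.1 (5.4)–(5.5) pp. 1089–1090, the SRW step law
and its transform); [MS93] = `MadrasSlade1993` (Cor. 5.3.2 (5.3.3), reprint PDF p. 148); [FvdH17] =
`FitznerVanDerHofstad2017` (§4.2 (4.18); notebook: the class tables of the explicit terms).
-/

namespace Literature.Probability.FitznerVanDerHofstad2017

open _root_.MeasureTheory Finset Polynomial
open Literature.Barriers.CriticalPhenomena Literature.Probability.Percolation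
open Literature.Probability.LatticeModels
open SrwCount (walk1 walk1K walk1K_eq walk1_succ walk1_neg coordD G G_succ G_zero srwCount getD_map_range
  sum_map_range)
open scoped BigOperators

variable {d : ℕ}

/-! ### §1. Packing a coefficient list into one natural number; the list polynomial -/

/-- `egfPack B [r₀, r₁, …, r_n] = Σ_a r_a B^a` (Horner; the Kronecker substitution `X ↦ B`). [folklore] -/
private def egfPack (B : ℕ) : List ℕ → ℕ
  | [] => 0
  | a :: t => a + B * egfPack B t

/-- The polynomial `Σ_a r_a X^a` of a coefficient list. [folklore] -/
private noncomputable def egfPoly : List ℕ → ℕ[X]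
  | [] => 0
  | a :: t => C a + X * egfPoly t

/-- `(egfPoly r).eval B = egfPack B r`. [folklore] -/
private theorem eval_egfPoly (B : ℕ) : ∀ r : List ℕ, (egfPoly r).eval B = egfPack B r
  | [] => by simp [egfPoly, egfPack]
  | a :: t => by
      rw [egfPoly, egfPack, eval_add, eval_C, eval_mul, eval_X, eval_egfPoly B t]

/-- `(egfPoly r).coeff n = r_n` (`0` beyond the list). [folklore] -/
private theorem coeff_egfPoly : ∀ (r : List ℕ) (n : ℕ), (egfPoly r).coeff n = r.getD n 0
  | [], n => by simp [egfPoly]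
  | a :: t, 0 => by simp [egfPoly]
  | a :: t, n + 1 => by
      rw [egfPoly, coeff_add, coeff_C, if_neg (Nat.succ_ne_zero n), coeff_X_mul, coeff_egfPoly t n, zero_add,
        List.getD_cons_succ]

/-! ### §2. Reading the coefficients of a polynomial back from its value at a large base -/

/-- **Digit extraction**: if every coefficient of `P ∈ ℕ[X]` is `< B`, then `P(B) / B^m % B = [X^m] P`.
[folklore] -/
private theorem eval_div_pow_mod_eq_coeff {B : ℕ} (hB : 0 < B) :
    ∀ (m : ℕ) (P : ℕ[X]), (∀ n, P.coeff n < B) → P.eval B / B ^ m % B = P.coeff m := by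
  intro m
  induction m with
  | zero =>
      intro P hP
      have h := congrArg (eval B) (X_mul_divX_add P)
      rw [eval_add, eval_mul, eval_X, eval_C] at h
      rw [pow_zero, Nat.div_one, ← h, Nat.mul_add_mod, Nat.mod_eq_of_lt (hP 0)]
  | succ m ih =>
      intro P hP
      have h := congrArg (eval B) (X_mul_divX_add P)
      rw [eval_add, eval_mul, eval_X, eval_C] at h
      rw [← h, pow_succ', ← Nat.div_div_eq_div_mul, Nat.add_comm, Nat.add_mul_div_left _ _ hB,
        Nat.div_eq_of_lt (hP 0), zero_add, ih (divX P) fun n => by rw [coeff_divX]; exact hP (n + 1)]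
      rw [coeff_divX]

/-! ### §3. Coefficient bounds for products with a factor of bounded degree -/

/-- If `q` has coefficients `≤ Mq` vanishing beyond degree `L` and `p` has coefficients `≤ Mp`, then `q · p` has
coefficients `≤ (L+1) · Mq · Mp`. [folklore] -/
private theorem coeff_mul_le_of_bounds {p q : ℕ[X]} {Mp Mq L : ℕ} (hp : ∀ n, p.coeff n ≤ Mp)
    (hq : ∀ n, q.coeff n ≤ Mq) (hqL : ∀ n, L < n → q.coeff n = 0) (n : ℕ) :
    (q * p).coeff n ≤ (L + 1) * Mq * Mp := by
  rw [coeff_mul, Finset.Nat.sum_antidiagonal_eq_sum_range_succ_mk]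
  calc ∑ k ∈ range n.succ, q.coeff k * p.coeff (n - k)
      ≤ ∑ k ∈ range n.succ, (if k ≤ L then 1 else 0) * (Mq * Mp) := by
        refine sum_le_sum fun k _ => ?_
        by_cases hk : k ≤ L
        · rw [if_pos hk, one_mul]; exact Nat.mul_le_mul (hq k) (hp _)
        · rw [hqL k (lt_of_not_ge hk), zero_mul, if_neg hk, zero_mul]
    _ = #((range n.succ).filter fun k => k ≤ L) * (Mq * Mp) := by rw [← sum_mul, sum_boole]; simp
    _ ≤ (L + 1) * (Mq * Mp) := by
        refine Nat.mul_le_mul_right _ ?_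
        calc #((range n.succ).filter fun k => k ≤ L) ≤ #(range (L + 1)) :=
              card_le_card fun k hk => by
                rw [mem_filter] at hk; exact mem_range.2 (Nat.lt_succ_of_le hk.2)
          _ = L + 1 := card_range _
    _ = (L + 1) * Mq * Mp := by rw [mul_assoc]

/-! ### §4. The scaled one-dimensional exponential generating polynomials -/

/-- `walk1 a y ≤ 2^a` (a 1-D walk makes `a` binary choices). [folklore] -/
private theorem walk1_le_two_pow : ∀ (a : ℕ) (y : ℤ), walk1 a y ≤ 2 ^ a
  | 0, y => by rw [SrwCount.walk1_zero]; split_ifs <;> simp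
  | a + 1, y => by
      rw [walk1_succ, pow_succ, mul_two]
      exact Nat.add_le_add (walk1_le_two_pow a _) (walk1_le_two_pow a _)

/-- **The scaled 1-D EGF coefficient list** `srwEgf1 L c = [u_{c,0}, …, u_{c,L}]`, `u_{c,a} = walk1(a,c) · L!/a!`
(kernel form `walk1K (c+L) a c` of `walk1 a c`): `L! ·` the degree-`≤ L` truncation of the exponential generating
function `Σ_a walk1(a,c) s^a/a!` of the one-dimensional `a`-step counts `0 → c` (the coordinate factor of the
`d`-dimensional step law, which is the uniform mixture of the `2d` coordinate moves).
[cite: FitznerVanDerHofstad2016NoBLE, §5.1.1 (5.4)–(5.5) pp. 1089–1090 (the SRW n-step law / its transform D̂(k)^n, D̂ = d⁻¹ Σ_μ cos k_μ)] -/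
def srwEgf1 (L c : ℕ) : List ℕ :=
  (List.range (L + 1)).map fun a => walk1K (c + L) a (c : ℤ) * (L.factorial / a.factorial)

/-- Coefficient `a ≤ L` of the scaled EGF: `walk1 a c · (L!/a!)`. [folklore] -/
private theorem coeff_egfPoly_srwEgf1_of_le {L c a : ℕ} (ha : a ≤ L) :
    (egfPoly (srwEgf1 L c)).coeff a = walk1 a (c : ℤ) * (L.factorial / a.factorial) := by
  rw [coeff_egfPoly, srwEgf1, getD_map_range _ (Nat.lt_succ_of_le ha), walk1K_eq]
  rw [Int.natAbs_natCast]; omega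

/-- Coefficients beyond `L` vanish. [folklore] -/
private theorem coeff_egfPoly_srwEgf1_of_lt {L c a : ℕ} (ha : L < a) : (egfPoly (srwEgf1 L c)).coeff a = 0 := by
  rw [coeff_egfPoly, srwEgf1, List.getD_eq_default]
  simpa using ha

/-- `a! · u_{c,a} = walk1(a,c) · L!` for `a ≤ L`. [folklore] -/
private theorem factorial_mul_coeff_srwEgf1 {L c a : ℕ} (ha : a ≤ L) :
    a.factorial * (egfPoly (srwEgf1 L c)).coeff a = walk1 a (c : ℤ) * L.factorial := by
  rw [coeff_egfPoly_srwEgf1_of_le ha, mul_left_comm, Nat.mul_div_cancel' (Nat.factorial_dvd_factorial ha)]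

/-- Every coefficient of the scaled EGF is `≤ 2^L · L!`. [folklore] -/
private theorem coeff_egfPoly_srwEgf1_le (L c a : ℕ) : (egfPoly (srwEgf1 L c)).coeff a ≤ 2 ^ L * L.factorial := by
  rcases Nat.lt_or_ge L a with ha | ha
  · rw [coeff_egfPoly_srwEgf1_of_lt ha]; exact Nat.zero_le _
  · rw [coeff_egfPoly_srwEgf1_of_le ha]
    exact Nat.mul_le_mul ((walk1_le_two_pow a _).trans (Nat.pow_le_pow_right (by norm_num) ha))
      (Nat.div_le_self _ _)

/-! ### §5. The product over the coordinates: `m! · [s^m] Π_{j<k} U_{|x_j|} = (L!)^k · G x k m` -/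

/-- The product of the scaled EGF polynomials of the first `k` coordinate magnitudes `c 0, …, c (k-1)`. [folklore] -/
private noncomputable def egfProd (L : ℕ) (c : ℕ → ℕ) : ℕ → ℕ[X]
  | 0 => 1
  | k + 1 => egfPoly (srwEgf1 L (c k)) * egfProd L c k

/-- Coefficients of the `k`-fold product are `≤ ((L+1)·(2^L·L!))^k`. [folklore] -/
private theorem coeff_egfProd_le (L : ℕ) (c : ℕ → ℕ) :
    ∀ k n, (egfProd L c k).coeff n ≤ ((L + 1) * (2 ^ L * L.factorial)) ^ k
  | 0, n => by
      rw [egfProd, pow_zero, coeff_one]; split_ifs <;> simp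
  | k + 1, n => by
      rw [egfProd, pow_succ, mul_comm (((L + 1) * _) ^ k)]
      exact coeff_mul_le_of_bounds (coeff_egfProd_le L c k) (coeff_egfPoly_srwEgf1_le L (c k))
        (fun n hn => coeff_egfPoly_srwEgf1_of_lt hn) n

/-- **The EGF product identity** (multinomial convolution of the coordinates): if `|x_j| = c j` for every `j`, then
for `m ≤ L`, `m! · [s^m] Π_{j<k} U_{c j}(s) = (L!)^k · G x k m` — at `k = d`, `(L!)^d · c_m(x)`.
[cite: FitznerVanDerHofstad2016NoBLE, §5.1.1 (5.4)–(5.5) pp. 1089–1090 (the SRW n-step law as the n-fold convolution of the uniform step law on the 2d coordinate moves)] -/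
theorem factorial_mul_coeff_egfProd {L : ℕ} {c : ℕ → ℕ} {x : Fin d → ℤ} (hx : ∀ j, (coordD x j).natAbs = c j) :
    ∀ (k m : ℕ), m ≤ L → m.factorial * (egfProd L c k).coeff m = L.factorial ^ k * G x k m
  | 0, m, _ => by
      rw [egfProd, coeff_one, G_zero, pow_zero, one_mul]
      split_ifs with h
      · subst h; simp
      · simp
  | k + 1, m, hm => by
      rw [egfProd, coeff_mul, G_succ, mul_sum, mul_sum]
      refine sum_congr rfl fun ij hij => ?_
      have hsum : ij.1 + ij.2 = m := Finset.mem_antidiagonal.1 hij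
      have h1 : ij.1 ≤ L := by omega
      have h2 : ij.2 ≤ m := by omega
      have hfac : m.factorial = m.choose ij.1 * ij.1.factorial * ij.2.factorial := by
        rw [← Nat.choose_mul_factorial_mul_factorial (show ij.1 ≤ m by omega), show m - ij.1 = ij.2 by omega]
      have hw : walk1 ij.1 (coordD x k) = walk1 ij.1 ((c k : ℕ) : ℤ) := by
        rw [← hx k]
        rcases Int.natAbs_eq (coordD x k) with h | h
        · exact congrArg _ h
        · conv_lhs => rw [h, walk1_neg]
      calc m.factorial * ((egfPoly (srwEgf1 L (c k))).coeff ij.1 * (egfProd L c k).coeff ij.2)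
          = m.choose ij.1 * (ij.1.factorial * (egfPoly (srwEgf1 L (c k))).coeff ij.1) *
              (ij.2.factorial * (egfProd L c k).coeff ij.2) := by rw [hfac]; ring
        _ = m.choose ij.1 * (walk1 ij.1 ((c k : ℕ) : ℤ) * L.factorial) * (L.factorial ^ k * G x k ij.2) := by
            rw [factorial_mul_coeff_srwEgf1 h1, factorial_mul_coeff_egfProd hx k ij.2 (h2.trans hm)]
        _ = L.factorial ^ (k + 1) * (m.choose ij.1 * (walk1 ij.1 (coordD x k) * G x k ij.2)) := by
            rw [hw, pow_succ]; ring

/-! ### §6. The fast row -/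

/-- **The packing base** `B = ((L+1)·2^L·L!)^d + 1`, strictly larger than every coefficient of the `d`-fold EGF
product (`coeff_egfProd_le`). [cite: FitznerVanDerHofstad2016NoBLE, §5.1.1 (5.4)–(5.5) pp. 1089–1090] -/
def srwEgfBase (d L : ℕ) : ℕ := ((L + 1) * (2 ^ L * L.factorial)) ^ d + 1

/-- **The packed product** `N = Π_{c ∈ cs} U_c(B) · U_0(B)^{d − |cs|}` of a coordinate-magnitude list `cs` (the
non-listed coordinates are `0`): `|cs|` multiplications and one power of natural numbers — the Kronecker
substitution `s ↦ B` of the EGF product. [cite: FitznerVanDerHofstad2016NoBLE, §5.1.1 (5.4)–(5.5) pp. 1089–1090] -/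
def srwEgfPacked (d L : ℕ) (cs : List ℕ) : ℕ :=
  ((cs.map fun c => egfPack (srwEgfBase d L) (srwEgf1 L c)).prod) *
    egfPack (srwEgfBase d L) (srwEgf1 L 0) ^ (d - cs.length)

/-- **Fast kernel row of the SRW end-point counts** `[c_0(x), …, c_L(x)]` for the point with coordinate
magnitudes `cs` (padded by zeros to `d` coordinates): coefficient `m` of the packed product, read back as
`N / B^m % B`, times `m!/(L!)^d`.  Agrees with `SrwCount.srwCountRow` (`srwCountRowFast_getD`); costs `O(d)`
big-number operations instead of `d` convolution levels.
[cite: FitznerVanDerHofstad2016NoBLE, §5.1.1 (5.4)–(5.5) pp. 1089–1090 (the SRW n-step law)] -/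
def srwCountRowFast (d L : ℕ) (cs : List ℕ) : List ℕ :=
  (List.range (L + 1)).map fun m =>
    srwEgfPacked d L cs / srwEgfBase d L ^ m % srwEgfBase d L * m.factorial / L.factorial ^ d

/-- `((List.range l.length).map fun j => f (l.getD j 0)) = l.map f`. [folklore] -/
private theorem map_getD_range {α β : Type*} (f : α → β) (a₀ : α) :
    ∀ l : List α, ((List.range l.length).map fun j => f (l.getD j a₀)) = l.map f
  | [] => rfl
  | a :: t => by
      rw [List.length_cons, List.range_succ_eq_map, List.map_cons, List.map_map, List.getD_cons_zero, List.map_cons]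
      congr 1
      simp only [Function.comp_def, Nat.succ_eq_add_one, List.getD_cons_succ]
      exact map_getD_range f a₀ t

/-- The packed product is the value at `B` of the `d`-fold EGF product of the padded magnitudes. [folklore] -/
private theorem srwEgfPacked_eq_eval {L : ℕ} {cs : List ℕ} (hcs : cs.length ≤ d) :
    srwEgfPacked d L cs = (egfProd L (fun j => cs.getD j 0) d).eval (srwEgfBase d L) := by
  have hprod : ∀ k, egfProd L (fun j => cs.getD j 0) k =
      ((List.range k).map fun j => egfPoly (srwEgf1 L (cs.getD j 0))).prod := by
    intro k
    induction k with
    | zero => simp [egfProd]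
    | succ k ih => rw [egfProd, ih, List.range_succ, List.map_append, List.prod_append, List.map_singleton,
        List.prod_singleton, mul_comm]
  have hl : ∀ (B : ℕ) (cs' : List ℕ), ((cs'.map fun c => egfPoly (srwEgf1 L c)).prod).eval B =
      (cs'.map fun c => egfPack B (srwEgf1 L c)).prod := by
    intro B cs'
    induction cs' with
    | nil => simp
    | cons c t ih => rw [List.map_cons, List.prod_cons, eval_mul, ih, eval_egfPoly, List.map_cons, List.prod_cons]
  obtain ⟨k, hk⟩ := Nat.exists_eq_add_of_le hcs
  subst hk
  have hmap := map_getD_range (fun c => egfPoly (srwEgf1 L c)) 0 cs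
  beta_reduce at hmap
  rw [hprod, List.range_add, List.map_append, List.prod_append, hmap, List.map_map]
  have hconst : ((List.range k).map ((fun j => egfPoly (srwEgf1 L (cs.getD j 0))) ∘ fun x => cs.length + x)) =
      List.replicate k (egfPoly (srwEgf1 L 0)) := by
    rw [List.eq_replicate_iff]
    refine ⟨by simp, fun p hp => ?_⟩
    obtain ⟨j, -, rfl⟩ := List.mem_map.1 hp
    simp
  rw [hconst, List.prod_replicate, srwEgfPacked, eval_mul, eval_pow, eval_egfPoly, hl,
    show cs.length + k - cs.length = k by omega]

/-- **Bridge**: for `m ≤ L`, `|cs| ≤ d` and a point `x` with coordinate magnitudes `|x_j| = cs_j` (`0` beyond the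
list), entry `m` of the fast row is `c_m(x) = srwCount d m x`.
[cite: FitznerVanDerHofstad2016NoBLE, §5.1.1 (5.4)–(5.5) pp. 1089–1090 (the SRW n-step law)] -/
theorem srwCountRowFast_getD {L m : ℕ} {cs : List ℕ} {x : Fin d → ℤ} (hcs : cs.length ≤ d)
    (hx : ∀ j, (coordD x j).natAbs = cs.getD j 0) (hm : m ≤ L) :
    (srwCountRowFast d L cs).getD m 0 = srwCount d m x := by
  have hB : 0 < srwEgfBase d L := Nat.succ_pos _
  have hcoef : ∀ n, (egfProd L (fun j => cs.getD j 0) d).coeff n < srwEgfBase d L := fun n =>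
    Nat.lt_succ_of_le (coeff_egfProd_le L _ d n)
  have hid := factorial_mul_coeff_egfProd (L := L) hx d m hm
  have hL : 0 < L.factorial ^ d := pow_pos (Nat.factorial_pos L) d
  rw [srwCountRowFast, getD_map_range _ (Nat.lt_succ_of_le hm), srwEgfPacked_eq_eval hcs,
    eval_div_pow_mod_eq_coeff hB m _ hcoef, mul_comm, hid, srwCount, Nat.mul_div_cancel_left _ hL]

/-! ### §7. Fast rows of the non-backtracking counts and the class atoms -/

/-- **Fast kernel row of the NBW end-point counts** `[b_0(x), …, b_L(x)]` (`b_n = Σ_j [P_n]_j c_j`, MS93 (5.3.3))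
over the fast SRW row. [cite: MadrasSlade1993, Cor. 5.3.2 (5.3.3) (reprint PDF p. 148)] -/
def nbwCountRowFast (d L : ℕ) (cs : List ℕ) : List ℤ :=
  let row := srwCountRowFast d L cs
  (List.range (L + 1)).map fun n => nbwDot (nbwPolyCoef d n) row

/-- **Bridge**: entry `n ≤ L` of the fast NBW row is `b_n(x) = #nbwWordsTo d n x` (`|x_j| = cs_j`, `|cs| ≤ d`).
[cite: MadrasSlade1993, Cor. 5.3.2 (5.3.3) (reprint PDF p. 148)]
[cite: FitznerVanDerHofstad2016NoBLE, §1.2.2 (1.21) (arXiv numbering)] -/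
theorem nbwCountRowFast_getD {L n : ℕ} {cs : List ℕ} {x : Site d} (hcs : cs.length ≤ d)
    (hx : ∀ j, (coordD x j).natAbs = cs.getD j 0) (hn : n ≤ L) :
    (nbwCountRowFast d L cs).getD n 0 = ((nbwWordsTo d n x).card : ℤ) := by
  rw [nbwCountRowFast, getD_map_range _ (by omega) _, nbwDot, sum_map_range, card_nbwWordsTo_eq_nbwEval, nbwEval]
  refine sum_congr rfl fun j hj => ?_
  have hj' : j ≤ n := by have := mem_range.1 hj; rw [length_nbwPolyCoef] at this; omega
  rw [srwCountRowFast_getD hcs hx (le_trans hj' hn)]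

/-- The coordinate-magnitude list of the canonical point of a multiplicity list: `coordList 1 l` read as naturals
(`l₀` ones, `l₁` twos, …). [cite: FitznerVanDerHofstad2016NoBLE, §5.3.3 p. 1098 (one representative per class of end points)] -/
def canonMagnitudes (l : List ℕ) : List ℕ := (coordList 1 l).map Int.toNat

/-- `coordList w l` has `Σ l` entries, all equal to casts of naturals `≥ w`. [folklore] -/
private theorem coordList_facts : ∀ (w : ℕ) (l : List ℕ),
    (coordList w l).length = l.sum ∧ ∀ z ∈ coordList w l, ∃ v : ℕ, z = (v : ℤ)
  | w, [] => by simp [coordList]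
  | w, a :: t => by
      obtain ⟨hlen, hmem⟩ := coordList_facts (w + 1) t
      refine ⟨by simp [coordList, hlen], fun z hz => ?_⟩
      simp only [coordList, List.mem_append, List.mem_replicate] at hz
      rcases hz with ⟨-, rfl⟩ | hz
      · exact ⟨w, rfl⟩
      · exact hmem z hz

/-- `|canonMagnitudes l| = Σ l`. [folklore] -/
private theorem length_canonMagnitudes (l : List ℕ) : (canonMagnitudes l).length = l.sum := by
  rw [canonMagnitudes, List.length_map, (coordList_facts 1 l).1]

/-- The coordinate magnitudes of `canonSite d l` are `canonMagnitudes l` (padded by zeros), provided `Σ l ≤ d`.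
[folklore] -/
private theorem natAbs_coordD_canonSite {l : List ℕ} (hl : l.sum ≤ d) (j : ℕ) :
    (coordD (canonSite d l) j).natAbs = (canonMagnitudes l).getD j 0 := by
  unfold coordD
  split_ifs with hj
  · change ((coordList 1 l).getD j 0).natAbs = _
    rw [canonMagnitudes, ← Int.toNat_zero, List.getD_map]
    rcases Nat.lt_or_ge j (coordList 1 l).length with hlt | hle
    · obtain ⟨v, hv⟩ := (coordList_facts 1 l).2 _ (List.getElem_mem hlt)
      rw [List.getD_eq_getElem _ _ hlt, hv, Int.natAbs_natCast, Int.toNat_natCast]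
    · rw [List.getD_eq_default _ _ hle]; rfl
  · rw [Int.natAbs_zero, List.getD_eq_default]
    rw [length_canonMagnitudes]; omega

/-- The fast SRW row of a live class: entry `m ≤ L` of `srwCountRowFast d L (canonMagnitudes l)` is
`c_m(canonSite d l)`, provided `Σ l ≤ d`. [cite: FitznerVanDerHofstad2016NoBLE, §5.1.1 (5.4)–(5.5) pp. 1089–1090] -/
theorem srwCountRowFast_canonMagnitudes_getD {L m : ℕ} {l : List ℕ} (hl : l.sum ≤ d) (hm : m ≤ L) :
    (srwCountRowFast d L (canonMagnitudes l)).getD m 0 = srwCount d m (canonSite d l) :=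
  srwCountRowFast_getD (by rw [length_canonMagnitudes]; exact hl) (natAbs_coordD_canonSite hl) hm

/-- **The fast NBW table atom of a class**: `nbwAtomFast d L l r = b_r(canonSite d l)` read off the fast row of cut
`L` (valid for `r ≤ L`, `Σ l ≤ d`). [cite: MadrasSlade1993, Cor. 5.3.2 (5.3.3) (reprint PDF p. 148)]
[cite: FitznerVanDerHofstad2016NoBLE, §5.3.3 p. 1098 (the explicit terms, class by class)] -/
def nbwAtomFast (d L : ℕ) (l : List ℕ) (r : ℕ) : ℤ := (nbwCountRowFast d L (canonMagnitudes l)).getD r 0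

/-- `nbwAtomFast d L l r = #nbwWordsTo d r (canonSite d l)` for `r ≤ L`, `Σ l ≤ d`.
[cite: MadrasSlade1993, Cor. 5.3.2 (5.3.3) (reprint PDF p. 148)] -/
theorem nbwAtomFast_eq_card {L r : ℕ} {l : List ℕ} (hl : l.sum ≤ d) (hr : r ≤ L) :
    nbwAtomFast d L l r = ((nbwWordsTo d r (canonSite d l)).card : ℤ) :=
  nbwCountRowFast_getD (by rw [length_canonMagnitudes]; exact hl) (natAbs_coordD_canonSite hl) hr

/-- The fast atom agrees with the atom of `NbwCountKernel`: `nbwAtomFast d L l r = nbwAtom d L' l r` whenever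
`r ≤ L`, `r ≤ L'`, `Σ l ≤ d`. [cite: MadrasSlade1993, Cor. 5.3.2 (5.3.3) (reprint PDF p. 148)] -/
theorem nbwAtomFast_eq_nbwAtom {L L' r : ℕ} {l : List ℕ} (hl : l.sum ≤ d) (hr : r ≤ L) (hr' : r ≤ L') :
    nbwAtomFast d L l r = nbwAtom d L' l r := by
  rw [nbwAtomFast_eq_card hl hr, nbwAtom_eq_card l hr']

/-- `0 ≤ nbwAtomFast` on its valid range. [cite: MadrasSlade1993, Cor. 5.3.2 (5.3.3) (reprint PDF p. 148)] -/
theorem nbwAtomFast_nonneg {L r : ℕ} {l : List ℕ} (hl : l.sum ≤ d) (hr : r ≤ L) : 0 ≤ nbwAtomFast d L l r := by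
  rw [nbwAtomFast_eq_card hl hr]; exact Int.natCast_nonneg _

/-! ### §8. Sanity evaluations (kernel, `decide +kernel`; counts only — no statement about percolation) -/

/-- The fast row agrees with `SrwCount.srwCountRow` on `ℤ²` at `x = (1,1)`, `L = 4`. [folklore] -/
example : srwCountRowFast 2 4 [1, 1] = SrwCount.srwCountRow 4 6 (![1, 1] : Fin 2 → ℤ) := by decide +kernel
/-- … and on `ℤ³` at `x = (2,0,0)`, `L = 6`. [folklore] -/
example : srwCountRowFast 3 6 [2] = SrwCount.srwCountRow 6 8 (![2, 0, 0] : Fin 3 → ℤ) := by decide +kernel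
/-- `d = 10`, class `(1,1,1,2)` (`l = [3,1]`): `b_15 = 30500556836400` (as in `NbwCountKernel` §6). [folklore] -/
example : nbwAtomFast 10 16 [3, 1] 15 = 30500556836400 := by decide +kernel
/-- `d = 10`, `x = (1,2,0,…,0)`: `b_21 = 695575272627636324879` (table-range size). [folklore] -/
example : (nbwCountRowFast 10 21 [1, 2]).getD 21 0 = 695575272627636324879 := by decide +kernel
/-- `d = 11`, `x = e₁`: `b_21 = 5428268542434537713960`. [folklore] -/
example : (nbwCountRowFast 11 22 [1]).getD 21 0 = 5428268542434537713960 := by decide +kernel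

end Literature.Probability.FitznerVanDerHofstad2017
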